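import Summits.Ventures.Crystal3D.Theorems.StickyWulffConstantCoaxialWallLawHealCap
import HarnessLib

/-!
# HEAL-CAP, cap-table row «HEXAGON MINUS ONE + lower triple»: at most THREE further contacts off the vacant site and the tips
# (crux `CoaxialWallLaw`, stmt-Ventures-19481; lane F v8 `JunkCapBound`)

HONEST FRAMING. Venture `Summits/Ventures/Crystal3D` (cell `crystal3d-full`); an elementary cap-packing lemma `--supports` the crux `CoaxialWallLaw`
(stmt-Ventures-19481, `route-Ventures-StickyWulffConstant`), line 'Certificates' v8/v8.1, analytic input `JunkCapBound` of `stub_incoherentSeamSmall`: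
the CAP TABLE row «five of the six hexagon slots and the lower triple occupied» (the slot `0` of the hexagon VACANT), expected cap `#empty − 1 = 3`
(19481-p2 g11), numerics 19481-p1 g17 calc/healcap_rows.py (three off-tip contacts exist, slack `0.046`).
THE ARGUMENT.  A further-contact direction `u` either satisfies `⟪u, slot 0⟫ ≤ 1/2` — then it is `HealFree` (all nine HEAL-CAP constraints) and at most
TWO such avoid the tips (`healFree_three`) — or lies in the LOBE `⟪u, slot 0⟫ > 1/2` (within `60°` of the vacant site).  **Lobe rigidity**
(`lobe_pair`): two lobe directions at mutual inner product `≤ 1/2` — one of them IS the vacant site `slot 0`.  In cubic coordinates with the orthogonal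
forms `P = x₀+x₁` (along the hole), `α = −x₀+x₁+x₂` (axial), `β = x₀−x₁+2x₂`: the hexagon neighbours `4, 9` of the hole give `|β| ≤ σ := √2 − P`, the
lower neighbour `5` gives `4α + β ≥ −3σ`, the unit sphere gives `α² ≥ 6cσ − 2σ² ≥ 4cσ`, hence `α ≥ 0`; for a pair, `⟪u,u'⟫ = PP'/2 + αα'/3 + ββ'/6 ≤ 1/2`
forces `(αα')² ≤ (3cσ)(3cσ') = (9/2)σσ'` against `(αα')² ≥ 16c²σσ' = 8σσ'`, so `σσ' = 0`.  So at most ONE lobe contact is off the site, and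
**`card_offTip_contacts_le_three_of_hexMinusOne`**: at most THREE further contacts avoid the eight balls, the vacant site and the six tips.
WHAT THIS IS NOT: no statement about pools or the stub; F-C1 not moved.
-/

noncomputable section

namespace Summit.Ventures.Crystal3D.Theorems

namespace TailResidue

open Summit.Ventures.Crystal3D Finset NearIdentity
open scoped InnerProductSpace

/-- The eight occupied slots: hexagon minus slot `0`, plus the lower triple. -/
def hexMinusOne : Finset (Fin 12) := {1, 3, 4, 5, 7, 9, 10, 11}

/-- A LOBE direction: unit, clear of the eight occupied slots, within `60°` of the vacant hexagon site `slot 0`. -/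
def LobeDir (u : EuclideanSpace ℝ (Fin 3)) : Prop :=
  ‖u‖ = 1 ∧ (∀ k ∈ hexMinusOne, ⟪u, slotSite k⟫_ℝ ≤ 1 / 2) ∧ 1 / 2 ≤ ⟪u, slotSite 0⟫_ℝ

/-! ### Lobe coordinates -/

/-- The orthogonal decomposition of the cubic norm along the hole `(1,1,0)`, the axis `(−1,1,1)` and `(1,−1,2)`. -/
theorem lobe_norm_identity (x0 x1 x2 : ℝ) :
    x0 ^ 2 + x1 ^ 2 + x2 ^ 2 = (x0 + x1) ^ 2 / 2 + (-x0 + x1 + x2) ^ 2 / 3 + (x0 - x1 + 2 * x2) ^ 2 / 6 := by ring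

/-- The corresponding polarisation identity. -/
theorem lobe_inner_identity (x0 x1 x2 y0 y1 y2 : ℝ) :
    x0 * y0 + x1 * y1 + x2 * y2 =
      (x0 + x1) * (y0 + y1) / 2 + (-x0 + x1 + x2) * (-y0 + y1 + y2) / 3 + (x0 - x1 + 2 * x2) * (y0 - y1 + 2 * y2) / 6 := by ring

set_option maxHeartbeats 400000 in
/-- **Lobe data** of a lobe direction, with `σ := 2c − (x₀+x₁)` (`c = √2/2`): `0 ≤ σ ≤ c`, `|β| ≤ σ`, `0 ≤ α`, `α² ≥ 4cσ`. -/
theorem LobeDir.data {u : EuclideanSpace ℝ (Fin 3)} (h : LobeDir u) :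
    0 ≤ 2 * (Real.sqrt 2 / 2) - (cubicCoords u 0 + cubicCoords u 1) ∧
    2 * (Real.sqrt 2 / 2) - (cubicCoords u 0 + cubicCoords u 1) ≤ Real.sqrt 2 / 2 ∧
    cubicCoords u 0 - cubicCoords u 1 + 2 * cubicCoords u 2 ≤ 2 * (Real.sqrt 2 / 2) - (cubicCoords u 0 + cubicCoords u 1) ∧
    -(2 * (Real.sqrt 2 / 2) - (cubicCoords u 0 + cubicCoords u 1)) ≤ cubicCoords u 0 - cubicCoords u 1 + 2 * cubicCoords u 2 ∧
    0 ≤ -cubicCoords u 0 + cubicCoords u 1 + cubicCoords u 2 ∧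
    4 * (Real.sqrt 2 / 2) * (2 * (Real.sqrt 2 / 2) - (cubicCoords u 0 + cubicCoords u 1)) ≤ (-cubicCoords u 0 + cubicCoords u 1 + cubicCoords u 2) ^ 2 := by
  obtain ⟨hn1, hocc, hlobe⟩ := h
  have hs : 0 < Real.sqrt 2 := by positivity
  have h2 : Real.sqrt 2 * Real.sqrt 2 = 2 := Real.mul_self_sqrt (by norm_num)
  have hc0 : 0 < Real.sqrt 2 / 2 := by positivity
  have hcc : (Real.sqrt 2 / 2) * (Real.sqrt 2 / 2) = 1 / 2 := by nlinarith
  have hn := cubicCoords_sq_sum hn1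
  have key : ∀ k ∈ hexMinusOne, cubicCoords u 0 * slotInt k 0 + cubicCoords u 1 * slotInt k 1 + cubicCoords u 2 * slotInt k 2 ≤ Real.sqrt 2 / 2 := by
    intro k hk
    have := hocc k hk
    rw [inner_slotSite_right, div_le_iff₀ hs] at this
    nlinarith
  have e4 := key 4 (by decide); have e9 := key 9 (by decide); have e5 := key 5 (by decide)
  simp only [slotInt, Matrix.cons_val_zero, Matrix.cons_val_one, Matrix.cons_val] at e4 e9 e5
  norm_num at e4 e9 e5
  -- the lobe inequality `x₀ + x₁ ≥ c`
  have hP : Real.sqrt 2 / 2 ≤ cubicCoords u 0 + cubicCoords u 1 := by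
    have := hlobe
    rw [inner_slotSite_right, le_div_iff₀ hs] at this
    simp only [slotInt, Matrix.cons_val_zero, Matrix.cons_val_one, Matrix.cons_val] at this
    norm_num at this
    nlinarith
  -- abbreviations (as plain facts)
  have hσ0 : 0 ≤ 2 * (Real.sqrt 2 / 2) - (cubicCoords u 0 + cubicCoords u 1) := by linarith
  have hσc : 2 * (Real.sqrt 2 / 2) - (cubicCoords u 0 + cubicCoords u 1) ≤ Real.sqrt 2 / 2 := by linarith
  have hβ1 : cubicCoords u 0 - cubicCoords u 1 + 2 * cubicCoords u 2 ≤ 2 * (Real.sqrt 2 / 2) - (cubicCoords u 0 + cubicCoords u 1) := by linarith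
  have hβ2 : -(2 * (Real.sqrt 2 / 2) - (cubicCoords u 0 + cubicCoords u 1)) ≤ cubicCoords u 0 - cubicCoords u 1 + 2 * cubicCoords u 2 := by linarith
  have hL : -3 * (2 * (Real.sqrt 2 / 2) - (cubicCoords u 0 + cubicCoords u 1)) ≤
      4 * (-cubicCoords u 0 + cubicCoords u 1 + cubicCoords u 2) + (cubicCoords u 0 - cubicCoords u 1 + 2 * cubicCoords u 2) := by linarith
  -- `α² ≥ 6cσ − 2σ² ≥ 4cσ`
  have hid := lobe_norm_identity (cubicCoords u 0) (cubicCoords u 1) (cubicCoords u 2)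
  set σ := 2 * (Real.sqrt 2 / 2) - (cubicCoords u 0 + cubicCoords u 1) with hσ
  set α := -cubicCoords u 0 + cubicCoords u 1 + cubicCoords u 2 with hα
  set β := cubicCoords u 0 - cubicCoords u 1 + 2 * cubicCoords u 2 with hβ
  have hPσ : cubicCoords u 0 + cubicCoords u 1 = 2 * (Real.sqrt 2 / 2) - σ := by rw [hσ]; ring
  have hβsq : β ^ 2 ≤ σ ^ 2 := by
    have hm := mul_nonneg (sub_nonneg.2 hβ1) (by linarith : 0 ≤ σ + β)
    have e : (σ - β) * (σ + β) = σ ^ 2 - β ^ 2 := by ring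
    linarith
  have hα2 : 6 * ((Real.sqrt 2 / 2) * σ) - 2 * σ ^ 2 ≤ α ^ 2 := by
    have h1 : (cubicCoords u 0 + cubicCoords u 1) ^ 2 / 2 + α ^ 2 / 3 + β ^ 2 / 6 = 1 := by rw [← hid]; exact hn
    rw [hPσ] at h1
    have e : (2 * (Real.sqrt 2 / 2) - σ) ^ 2 = 4 * ((Real.sqrt 2 / 2) * (Real.sqrt 2 / 2)) - 4 * ((Real.sqrt 2 / 2) * σ) + σ ^ 2 := by ring
    rw [e, hcc] at h1
    linarith
  have hα4 : 4 * (Real.sqrt 2 / 2) * σ ≤ α ^ 2 := by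
    have hm := mul_nonneg hσ0 (sub_nonneg.2 hσc)
    have e : σ * (Real.sqrt 2 / 2 - σ) = (Real.sqrt 2 / 2) * σ - σ ^ 2 := by ring
    have e' : 4 * (Real.sqrt 2 / 2) * σ = 4 * ((Real.sqrt 2 / 2) * σ) := by ring
    rw [e']; linarith
  refine ⟨hσ0, hσc, hβ1, hβ2, ?_, hα4⟩
  -- `α ≥ 0`
  by_contra hneg
  push Not at hneg
  have hαl : -α ≤ σ := by linarith
  have hsq : α ^ 2 ≤ σ ^ 2 := by
    have hm := mul_le_mul hαl hαl (by linarith) hσ0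
    have e : -α * -α = α ^ 2 := by ring
    have e' : σ * σ = σ ^ 2 := by ring
    linarith
  have hσσ : σ ^ 2 ≤ (Real.sqrt 2 / 2) * σ := by
    have hm := mul_le_mul_of_nonneg_right hσc hσ0
    have e' : σ * σ = σ ^ 2 := by ring
    linarith
  have hcσ : (Real.sqrt 2 / 2) * σ ≤ 0 := by
    have e' : 4 * (Real.sqrt 2 / 2) * σ = 4 * ((Real.sqrt 2 / 2) * σ) := by ring
    rw [e'] at hα4; linarith
  have hcσ0 : 0 ≤ (Real.sqrt 2 / 2) * σ := mul_nonneg hc0.le hσ0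
  have hz : σ = 0 := by
    have : (Real.sqrt 2 / 2) * σ = 0 := le_antisymm hcσ hcσ0
    rcases mul_eq_zero.1 this with h | h
    · exact absurd h (ne_of_gt hc0)
    · exact h
  rw [hz] at hsq
  have : α ^ 2 ≤ 0 := by simpa using hsq
  have hα0 : α = 0 := by nlinarith [sq_nonneg α]
  linarith

/-- **Real core of lobe rigidity**: `σσ' = 0`. -/
theorem lobe_core {c σ α β σ' α' β' : ℝ} (hc0 : 0 < c) (hcc : c * c = 1 / 2)
    (hσ : 0 ≤ σ) (hσc : σ ≤ c) (hβ : β ≤ σ) (hβ' : -σ ≤ β) (hα : 0 ≤ α) (hα4 : 4 * c * σ ≤ α ^ 2)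
    (gσ : 0 ≤ σ') (gσc : σ' ≤ c) (gβ : β' ≤ σ') (gβ' : -σ' ≤ β') (gα : 0 ≤ α') (gα4 : 4 * c * σ' ≤ α' ^ 2)
    (hI : (2 * c - σ) * (2 * c - σ') / 2 + α * α' / 3 + β * β' / 6 ≤ 1 / 2) : σ * σ' = 0 := by
  -- `ββ' ≥ −σσ'`
  have p1 : 0 ≤ (σ - β) * (σ' - β') := mul_nonneg (by linarith) (by linarith)
  have p2 : 0 ≤ (σ + β) * (σ' + β') := mul_nonneg (by linarith) (by linarith)
  have e1 : (σ - β) * (σ' - β') + (σ + β) * (σ' + β') = 2 * (σ * σ') + 2 * (β * β') := by ring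
  have hbb : -(σ * σ') ≤ β * β' := by linarith
  -- `αα' ≤ R := 3c(σ+σ') − 3/2 − σσ'` and `R ≤ 3cσ`, `R ≤ 3cσ'`
  have e2 : (2 * c - σ) * (2 * c - σ') = 4 * (c * c) - 2 * (c * σ) - 2 * (c * σ') + σ * σ' := by ring
  have hR : α * α' ≤ 3 * (c * σ) + 3 * (c * σ') - 3 / 2 - σ * σ' := by rw [e2, hcc] at hI; linarith
  have hcσ' : c * σ' ≤ 1 / 2 := by nlinarith
  have hcσ : c * σ ≤ 1 / 2 := by nlinarith
  have hss : 0 ≤ σ * σ' := mul_nonneg hσ gσ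
  have hR1 : α * α' ≤ 3 * (c * σ) := by linarith
  have hR2 : α * α' ≤ 3 * (c * σ') := by linarith
  have haa : 0 ≤ α * α' := mul_nonneg hα gα
  -- squares: `(αα')² ≥ 16c²σσ' = 8σσ'` but `(αα')² ≤ 9c²σσ' = (9/2)σσ'`
  have hlow : 8 * (σ * σ') ≤ (α * α') ^ 2 := by
    have := mul_le_mul hα4 gα4 (by nlinarith) (by positivity)
    have e3 : 4 * c * σ * (4 * c * σ') = 16 * (c * c) * (σ * σ') := by ring
    rw [e3, hcc] at this
    have e4 : α ^ 2 * α' ^ 2 = (α * α') ^ 2 := by ring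
    linarith [e4 ▸ this]
  have hup : (α * α') ^ 2 ≤ 9 / 2 * (σ * σ') := by
    have := mul_le_mul hR1 hR2 haa (by nlinarith)
    have e5 : 3 * (c * σ) * (3 * (c * σ')) = 9 * (c * c) * (σ * σ') := by ring
    rw [e5, hcc] at this
    nlinarith
  nlinarith

/-- Cubic coordinates of the vacant site `slot 0`. -/
theorem cubicCoords_slotSite_zero : cubicCoords (slotSite 0) = ![Real.sqrt 2 / 2, Real.sqrt 2 / 2, 0] := by
  have hs : 0 < Real.sqrt 2 := by positivity
  have h2 : Real.sqrt 2 * Real.sqrt 2 = 2 := Real.mul_self_sqrt (by norm_num)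
  rw [cubicCoords_slotSite]; ext i; fin_cases i <;> simp [slotVec, slotInt] <;> field_simp <;> nlinarith

/-- A lobe direction with `σ = 0` is the vacant site. -/
theorem LobeDir.eq_slot_zero {u : EuclideanSpace ℝ (Fin 3)} (h : LobeDir u)
    (hσ : 2 * (Real.sqrt 2 / 2) - (cubicCoords u 0 + cubicCoords u 1) = 0) : u = slotSite 0 := by
  obtain ⟨-, -, hβ1, hβ2, -, -⟩ := h.data
  have hn := cubicCoords_sq_sum h.1
  have hid := lobe_norm_identity (cubicCoords u 0) (cubicCoords u 1) (cubicCoords u 2)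
  have h2 : Real.sqrt 2 * Real.sqrt 2 = 2 := Real.mul_self_sqrt (by norm_num)
  have hP : cubicCoords u 0 + cubicCoords u 1 = 2 * (Real.sqrt 2 / 2) := by linarith
  have hβ : cubicCoords u 0 - cubicCoords u 1 + 2 * cubicCoords u 2 = 0 := by rw [hσ] at hβ1 hβ2; linarith
  have hα : (-cubicCoords u 0 + cubicCoords u 1 + cubicCoords u 2) ^ 2 = 0 := by
    rw [hn, hP, hβ] at hid; nlinarith
  have hα' : -cubicCoords u 0 + cubicCoords u 1 + cubicCoords u 2 = 0 := by
    have := sq_eq_zero_iff.1 hα; exact this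
  have x2 : cubicCoords u 2 = 0 := by linarith
  have x0 : cubicCoords u 0 = Real.sqrt 2 / 2 := by linarith
  have x1 : cubicCoords u 1 = Real.sqrt 2 / 2 := by linarith
  apply cubicCoords_injective
  rw [cubicCoords_slotSite_zero]; ext i; fin_cases i
  · exact x0
  · exact x1
  · exact x2

/-- **LOBE RIGIDITY**: two lobe directions at mutual inner product `≤ 1/2` — one of them is the vacant site `slot 0`. -/
theorem lobe_pair {u u' : EuclideanSpace ℝ (Fin 3)} (h : LobeDir u) (h' : LobeDir u') (huu : ⟪u, u'⟫_ℝ ≤ 1 / 2) :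
    u = slotSite 0 ∨ u' = slotSite 0 := by
  have hc0 : 0 < Real.sqrt 2 / 2 := by positivity
  have hcc : (Real.sqrt 2 / 2) * (Real.sqrt 2 / 2) = 1 / 2 := by
    have h2 : Real.sqrt 2 * Real.sqrt 2 = 2 := Real.mul_self_sqrt (by norm_num)
    nlinarith
  obtain ⟨hσ, hσc, hβ, hβ', hα, hα4⟩ := h.data
  obtain ⟨gσ, gσc, gβ, gβ', gα, gα4⟩ := h'.data
  have hI : cubicCoords u 0 * cubicCoords u' 0 + cubicCoords u 1 * cubicCoords u' 1 + cubicCoords u 2 * cubicCoords u' 2 ≤ 1 / 2 := by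
    rw [← inner_eq_cubicCoords_three]; exact huu
  rw [lobe_inner_identity] at hI
  have eP : cubicCoords u 0 + cubicCoords u 1 = 2 * (Real.sqrt 2 / 2) - (2 * (Real.sqrt 2 / 2) - (cubicCoords u 0 + cubicCoords u 1)) := by ring
  have eP' : cubicCoords u' 0 + cubicCoords u' 1 = 2 * (Real.sqrt 2 / 2) - (2 * (Real.sqrt 2 / 2) - (cubicCoords u' 0 + cubicCoords u' 1)) := by ring
  rw [eP, eP'] at hI
  have key := lobe_core hc0 hcc hσ hσc hβ hβ' hα hα4 gσ gσc gβ gβ' gα gα4 hI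
  rcases mul_eq_zero.1 key with h0 | h0
  · exact Or.inl (h.eq_slot_zero h0)
  · exact Or.inr (h'.eq_slot_zero h0)

/-! ### Packing form -/

/-- A further contact that is NOT heal-free towards the hole is a lobe direction; otherwise it is heal-free. -/
theorem contact_healFree_or_lobe {X : Finset (EuclideanSpace ℝ (Fin 3))} (hX : ∀ p ∈ X, ∀ q ∈ X, p ≠ q → 1 ≤ dist p q)
    (L : EuclideanSpace ℝ (Fin 3) ≃ₗᵢ[ℝ] EuclideanSpace ℝ (Fin 3)) {y x : EuclideanSpace ℝ (Fin 3)}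
    (hocc : ∀ k ∈ hexMinusOne, y + L (slotSite k) ∈ X) (hx : x ∈ X) (hd : dist y x = 1)
    (hne : ∀ k ∈ hexMinusOne, x ≠ y + L (slotSite k)) : HealFree (L.symm (x - y)) ∨ LobeDir (L.symm (x - y)) := by
  have hxy : ‖x - y‖ = 1 := by rw [← dist_eq_norm, dist_comm]; exact hd
  have hnorm : ‖L.symm (x - y)‖ = 1 := by rw [LinearIsometryEquiv.norm_map]; exact hxy
  have hk : ∀ k ∈ hexMinusOne, ⟪L.symm (x - y), slotSite k⟫_ℝ ≤ 1 / 2 := by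
    intro k hk
    have h1 : ⟪L.symm (x - y), slotSite k⟫_ℝ = ⟪x - y, L (slotSite k)⟫_ℝ := by
      rw [← L.inner_map_map (L.symm (x - y)) (slotSite k), LinearIsometryEquiv.apply_symm_apply]
    rw [h1]
    refine inner_le_half_of_norm_sub_ge_one hxy (by rw [LinearIsometryEquiv.norm_map]; exact norm_eq_one_of_mem_fccSlots (slotSite_mem k)) ?_
    have : x - y - L (slotSite k) = x - (y + L (slotSite k)) := by abel
    rw [this, ← dist_eq_norm]
    exact hX x hx _ (hocc k hk) (hne k hk)
  by_cases h0 : ⟪L.symm (x - y), slotSite 0⟫_ℝ ≤ 1 / 2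
  · left
    refine ⟨hnorm, fun k hk' => ?_⟩
    by_cases hk0 : k = 0
    · subst hk0; exact h0
    · refine hk k ?_
      simp only [lowerNine, mem_insert, mem_singleton] at hk'
      rcases hk' with rfl | rfl | rfl | rfl | rfl | rfl | rfl | rfl | rfl <;> first | exact absurd rfl hk0 | decide
  · right
    push Not at h0
    exact ⟨hnorm, hk, h0.le⟩

open scoped Classical in
/-- **Cap-table row «hexagon minus one + lower triple»**: in a `1`-separated configuration, a ball `y` with the eight positions
`y + L(slotSite k)`, `k ∈ hexMinusOne`, occupied has AT MOST THREE contacts that avoid those eight balls, the vacant site `y + L(slotSite 0)` and the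
six tips `y + L t`, `t ∈ healTips`. -/
theorem card_offTip_contacts_le_three_of_hexMinusOne {X : Finset (EuclideanSpace ℝ (Fin 3))}
    (hX : ∀ p ∈ X, ∀ q ∈ X, p ≠ q → 1 ≤ dist p q) (L : EuclideanSpace ℝ (Fin 3) ≃ₗᵢ[ℝ] EuclideanSpace ℝ (Fin 3))
    {y : EuclideanSpace ℝ (Fin 3)} (hocc : ∀ k ∈ hexMinusOne, y + L (slotSite k) ∈ X) :
    (X.filter fun x => dist y x = 1 ∧ (∀ k ∈ hexMinusOne, x ≠ y + L (slotSite k)) ∧ x ≠ y + L (slotSite 0) ∧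
      L.symm (x - y) ∉ healTips).card ≤ 3 := by
  set s := X.filter fun x => dist y x = 1 ∧ (∀ k ∈ hexMinusOne, x ≠ y + L (slotSite k)) ∧ x ≠ y + L (slotSite 0) ∧
      L.symm (x - y) ∉ healTips with hs
  by_contra hlt
  push Not at hlt
  have hin : ∀ {p q : EuclideanSpace ℝ (Fin 3)}, p ∈ X → q ∈ X → p ≠ q → dist y p = 1 → dist y q = 1 →
      ⟪L.symm (p - y), L.symm (q - y)⟫_ℝ ≤ 1 / 2 := by
    intro p q hp hq hpq hdp hdq
    rw [L.symm.inner_map_map]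
    refine inner_le_half_of_norm_sub_ge_one (by rw [← dist_eq_norm, dist_comm]; exact hdp)
      (by rw [← dist_eq_norm, dist_comm]; exact hdq) ?_
    have : p - y - (q - y) = p - q := by abel
    rw [this, ← dist_eq_norm]; exact hX p hp q hq hpq
  have back : ∀ {w}, L.symm (w - y) = slotSite 0 → w = y + L (slotSite 0) := by
    intro w h
    have : w - y = L (slotSite 0) := by rw [← h, LinearIsometryEquiv.apply_symm_apply]
    rw [← this]; abel
  let lobe : EuclideanSpace ℝ (Fin 3) → Prop := fun x => LobeDir (L.symm (x - y))
  have hsplit := Finset.card_filter_add_card_filter_not (s := s) lobe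
  rcases le_or_gt 2 (s.filter lobe).card with hU | hU
  · -- two lobe contacts: one of them is the vacant site
    obtain ⟨a, ha, b, hb, hab⟩ := one_lt_card.1 (by omega : 1 < (s.filter lobe).card)
    rw [mem_filter] at ha hb
    rw [hs, mem_filter] at ha hb
    obtain ⟨⟨haX, hda, -, hsa, -⟩, la⟩ := ha
    obtain ⟨⟨hbX, hdb, -, hsb, -⟩, lb⟩ := hb
    rcases lobe_pair la lb (hin haX hbX hab hda hdb) with h0 | h0
    · exact hsa (back h0)
    · exact hsb (back h0)
  · -- three non-lobe contacts: heal-free, hence tips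
    have hL : 2 < (s.filter fun x => ¬ lobe x).card := by omega
    obtain ⟨a, ha, b, hb, c, hc, hab, hac, hbc⟩ := two_lt_card.1 hL
    rw [mem_filter] at ha hb hc
    rw [hs, mem_filter] at ha hb hc
    obtain ⟨⟨haX, hda, hnea, -, hta⟩, la⟩ := ha
    obtain ⟨⟨hbX, hdb, hneb, -, -⟩, lb⟩ := hb
    obtain ⟨⟨hcX, hdc, hnec, -, -⟩, lc⟩ := hc
    have fa : HealFree (L.symm (a - y)) := (contact_healFree_or_lobe hX L hocc haX hda hnea).resolve_right la
    have fb : HealFree (L.symm (b - y)) := (contact_healFree_or_lobe hX L hocc hbX hdb hneb).resolve_right lb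
    have fc : HealFree (L.symm (c - y)) := (contact_healFree_or_lobe hX L hocc hcX hdc hnec).resolve_right lc
    obtain ⟨hta', -, -⟩ := healFree_three fa fb fc (hin haX hbX hab hda hdb) (hin haX hcX hac hda hdc) (hin hbX hcX hbc hdb hdc)
    exact hta hta'

/-! ### Junk form (appended): the non-capping hcp position next to the hole may be occupied -/

open Literature.MathematicalPhysics.StatisticalMechanics (basalMirror) in
open scoped Classical in
/-- **Cap-table row «hexagon minus one + lower triple», JUNK FORM.**  With the hexagon slot `0` vacant, the hcp position
`basalMirror (slotSite 5)` (above the triangle `y, slot 0, slot 9`) no longer caps a triangle of occupied balls, so closure maximality does not keep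
junk off it.  Allowing a contact AT that one position changes nothing: a ball `y` with the eight positions `y + L(slotSite k)`, `k ∈ hexMinusOne`,
occupied has AT MOST THREE contacts that avoid those eight balls, the vacant site `y + L(slotSite 0)`, and the FIVE other tips (three heal-free
contacts are three DISTINCT tips by `healFree_three`, so at most one of them is the allowed one). -/
theorem card_junk_contacts_le_three_of_hexMinusOne {X : Finset (EuclideanSpace ℝ (Fin 3))}
    (hX : ∀ p ∈ X, ∀ q ∈ X, p ≠ q → 1 ≤ dist p q) (L : EuclideanSpace ℝ (Fin 3) ≃ₗᵢ[ℝ] EuclideanSpace ℝ (Fin 3))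
    {y : EuclideanSpace ℝ (Fin 3)} (hocc : ∀ k ∈ hexMinusOne, y + L (slotSite k) ∈ X) :
    (X.filter fun x => dist y x = 1 ∧ (∀ k ∈ hexMinusOne, x ≠ y + L (slotSite k)) ∧ x ≠ y + L (slotSite 0) ∧
      (L.symm (x - y) ∈ healTips → L.symm (x - y) = basalMirror (slotSite 5))).card ≤ 3 := by
  set s := X.filter fun x => dist y x = 1 ∧ (∀ k ∈ hexMinusOne, x ≠ y + L (slotSite k)) ∧ x ≠ y + L (slotSite 0) ∧
      (L.symm (x - y) ∈ healTips → L.symm (x - y) = basalMirror (slotSite 5)) with hs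
  by_contra hlt
  push Not at hlt
  have hin : ∀ {p q : EuclideanSpace ℝ (Fin 3)}, p ∈ X → q ∈ X → p ≠ q → dist y p = 1 → dist y q = 1 →
      ⟪L.symm (p - y), L.symm (q - y)⟫_ℝ ≤ 1 / 2 := by
    intro p q hp hq hpq hdp hdq
    rw [L.symm.inner_map_map]
    refine inner_le_half_of_norm_sub_ge_one (by rw [← dist_eq_norm, dist_comm]; exact hdp)
      (by rw [← dist_eq_norm, dist_comm]; exact hdq) ?_
    have : p - y - (q - y) = p - q := by abel
    rw [this, ← dist_eq_norm]; exact hX p hp q hq hpq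
  have back : ∀ {w} {t : EuclideanSpace ℝ (Fin 3)}, L.symm (w - y) = t → w = y + L t := by
    intro w t h
    have : w - y = L t := by rw [← h, LinearIsometryEquiv.apply_symm_apply]
    rw [← this]; abel
  let lobe : EuclideanSpace ℝ (Fin 3) → Prop := fun x => LobeDir (L.symm (x - y))
  have hsplit := Finset.card_filter_add_card_filter_not (s := s) lobe
  rcases le_or_gt 2 (s.filter lobe).card with hU | hU
  · obtain ⟨a, ha, b, hb, hab⟩ := one_lt_card.1 (by omega : 1 < (s.filter lobe).card)
    rw [mem_filter] at ha hb
    rw [hs, mem_filter] at ha hb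
    obtain ⟨⟨haX, hda, -, hsa, -⟩, la⟩ := ha
    obtain ⟨⟨hbX, hdb, -, hsb, -⟩, lb⟩ := hb
    rcases lobe_pair la lb (hin haX hbX hab hda hdb) with h0 | h0
    · exact hsa (back h0)
    · exact hsb (back h0)
  · have hL : 2 < (s.filter fun x => ¬ lobe x).card := by omega
    obtain ⟨a, ha, b, hb, c, hc, hab, hac, hbc⟩ := two_lt_card.1 hL
    rw [mem_filter] at ha hb hc
    rw [hs, mem_filter] at ha hb hc
    obtain ⟨⟨haX, hda, hnea, -, hta⟩, la⟩ := ha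
    obtain ⟨⟨hbX, hdb, hneb, -, htb⟩, lb⟩ := hb
    obtain ⟨⟨hcX, hdc, hnec, -, -⟩, lc⟩ := hc
    have fa : HealFree (L.symm (a - y)) := (contact_healFree_or_lobe hX L hocc haX hda hnea).resolve_right la
    have fb : HealFree (L.symm (b - y)) := (contact_healFree_or_lobe hX L hocc hbX hdb hneb).resolve_right lb
    have fc : HealFree (L.symm (c - y)) := (contact_healFree_or_lobe hX L hocc hcX hdc hnec).resolve_right lc
    obtain ⟨hta', htb', -⟩ := healFree_three fa fb fc (hin haX hbX hab hda hdb) (hin haX hcX hac hda hdc) (hin hbX hcX hbc hdb hdc)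
    -- `a` and `b` are both the allowed tip: equal directions, hence equal points
    have ea := hta hta'
    have eb := htb htb'
    exact hab (by rw [back ea, back eb])

end TailResidue

end Summit.Ventures.Crystal3D.Theorems

end
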